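/-
Copyright (c) 2026. All rights reserved.
Released under Apache 2.0 license as described in the file LICENSE.
Authors: abc-iut cell, seat abc-iut-L4-t15 (gen 6).
-/
import Mathlib.Topology.Algebra.Group.Basic
import Mathlib.Topology.Constructions
import Mathlib.GroupTheory.Commutator.Basic
import Mathlib.Algebra.Group.Subgroup.Pointwise

/-!
# Transport between a topological group and an open subgroup

Bookkeeping lemmas for proving a statement about normal subgroups `P' ≤ U` of a topological group `G`
by working inside the open subgroup `U` (as the group `↥U`):

* `exists_isOpen_inf_le_commutator_sup_pow_of_subgroupOf` — if, inside `↥U`, some open `V_U` satisfies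
  `V_U ⊓ P'_U ≤ ⁅P'_U, ⊤⁆ ⊔ ⟨n-th powers of P'_U⟩` (with `P'_U = P'.subgroupOf U`), then in `G` some open
  `V` satisfies `V ⊓ P' ≤ ⁅P', U⁆ ⊔ ⟨n-th powers of P'⟩`;
* `exists_isOpen_inf_subgroupOf_le` — an open `V ≤ G` with `V ⊓ P ≤ P'` gives an open `V_U ≤ ↥U` with
  `V_U ⊓ P_U ≤ P'_U`;
* `forall_nhds_pow_mem_subgroupOf` — "`x ^ (p ^ k) → 1`" passes to `↥U`.

Mathlib-only; no definitions, no instances (cell abc-iut, GAP-LEDGER G-L3d2g2-1: the inheritance step of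
the strong-completeness reduction for `p`-by-metacyclic profinite groups).
[cite: RibesZalesskii2010, §2.1]
-/

namespace Literature.GroupTheory

open scoped Pointwise

variable {G : Type*} [Group G] [TopologicalSpace G]

/-- **Descent of the conclusion from an open subgroup.**  Let `U ≤ G` be open and `P' ≤ U`.  If inside
`↥U` there is an open subgroup `V_U` with `V_U ⊓ P'_U ≤ ⁅P'_U, ⊤⁆ ⊔ ⟨y | ∃ x ∈ P'_U, x ^ n = y⟩`
(`P'_U = P'.subgroupOf U`), then there is an open subgroup `V ≤ G` with
`V ⊓ P' ≤ ⁅P', U⁆ ⊔ ⟨y | ∃ x ∈ P', x ^ n = y⟩`. [cite: RibesZalesskii2010, §2.1] -/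
theorem exists_isOpen_inf_le_commutator_sup_pow_of_subgroupOf (U : Subgroup G)
    (hUo : IsOpen (U : Set G)) (P' : Subgroup G) (hP'U : P' ≤ U) (n : ℕ)
    (h : ∃ V : Subgroup U, IsOpen (V : Set U) ∧
      V ⊓ P'.subgroupOf U ≤ ⁅P'.subgroupOf U, (⊤ : Subgroup U)⁆ ⊔
        Subgroup.closure {y : U | ∃ x ∈ P'.subgroupOf U, x ^ n = y}) :
    ∃ V : Subgroup G, IsOpen (V : Set G) ∧
      V ⊓ P' ≤ ⁅P', U⁆ ⊔ Subgroup.closure {y : G | ∃ x ∈ P', x ^ n = y} := by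
  obtain ⟨V, hVo, hV⟩ := h
  refine ⟨V.map U.subtype, ?_, ?_⟩
  · rw [Subgroup.coe_map]
    exact hUo.isOpenMap_subtype_val _ hVo
  · rintro x ⟨⟨v, hv, rfl⟩, hxP'⟩
    have hv' : v ∈ V ⊓ P'.subgroupOf U := ⟨hv, Subgroup.mem_subgroupOf.mpr hxP'⟩
    have hx : (U.subtype v : G) ∈ (⁅P'.subgroupOf U, (⊤ : Subgroup U)⁆ ⊔
        Subgroup.closure {y : U | ∃ x ∈ P'.subgroupOf U, x ^ n = y}).map U.subtype :=
      ⟨v, hV hv', rfl⟩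
    have hUtop : (⊤ : Subgroup U).map U.subtype = U := by
      rw [← MonoidHom.range_eq_map, Subgroup.range_subtype]
    rw [Subgroup.map_sup, Subgroup.map_commutator, Subgroup.subgroupOf_map_subtype,
      inf_eq_left.mpr hP'U, hUtop, MonoidHom.map_closure] at hx
    refine (sup_le_sup_left (Subgroup.closure_mono ?_) _) hx
    rintro _ ⟨y, ⟨z, hz, rfl⟩, rfl⟩
    exact ⟨(z : G), Subgroup.mem_subgroupOf.mp hz, by simp⟩

/-- **Ascent of the openness hypothesis to an open subgroup.**  An open `V ≤ G` with `V ⊓ P ≤ P'` gives,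
inside `↥U`, the open subgroup `V.subgroupOf U` with `V_U ⊓ P_U ≤ P'_U`. [cite: RibesZalesskii2010, §2.1] -/
theorem exists_isOpen_inf_subgroupOf_le (U P P' : Subgroup G)
    (h : ∃ V : Subgroup G, IsOpen (V : Set G) ∧ V ⊓ P ≤ P') :
    ∃ V : Subgroup U, IsOpen (V : Set U) ∧ V ⊓ P.subgroupOf U ≤ P'.subgroupOf U := by
  obtain ⟨V, hVo, hV⟩ := h
  refine ⟨V.subgroupOf U, hVo.preimage continuous_subtype_val, ?_⟩
  rintro v ⟨hvV, hvP⟩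
  exact Subgroup.mem_subgroupOf.mpr
    (hV ⟨Subgroup.mem_subgroupOf.mp hvV, Subgroup.mem_subgroupOf.mp hvP⟩)

/-- **`p`-power convergence passes to a subgroup.**  If `x ^ (p ^ k) → 1` in `G` for every `x ∈ P`
(every neighbourhood of `1` contains some `x ^ (p ^ k)`), the same holds in `↥U` for `P.subgroupOf U`.
[cite: RibesZalesskii2010, §2.1] -/
theorem forall_nhds_pow_mem_subgroupOf (U P : Subgroup G) {p : ℕ}
    (hPp : ∀ x ∈ P, ∀ O ∈ nhds (1 : G), ∃ k : ℕ, x ^ p ^ k ∈ O) :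
    ∀ x ∈ P.subgroupOf U, ∀ O ∈ nhds (1 : U), ∃ k : ℕ, x ^ p ^ k ∈ O := by
  intro x hx O hO
  rw [nhds_subtype, Filter.mem_comap] at hO
  obtain ⟨O', hO', hsub⟩ := hO
  obtain ⟨k, hk⟩ := hPp (x : G) (Subgroup.mem_subgroupOf.mp hx) O' (by simpa using hO')
  exact ⟨k, hsub (by simpa using hk)⟩

end Literature.GroupTheory
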